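import Literature.Probability.Percolation.AltFourArmStability
import Literature.Probability.Percolation.ArmExponentsFourArmAlt
import HarnessLib

/-!
# Preparations for the bootstrap of the four-arm arrangement bridge below `L(p)` (proofs only)

Topic `Literature/Probability/Percolation`; family `crit-perc`. PROOFS ONLY (no definition, no
named fact). Elementary inputs of a bootstrap ("continuity") argument deriving the near-critical
comparison of the two cyclic arrangements of four arms — `c · π̂_t(n, N) ≤ π̂^alt_t(n, N)` below
Werner's length `L(t, ε)`, the hypothesis `(Br)` of `FourArmStabilityFromAltPattern.lean` — from
its critical case (Nolin 2008, Prop. 20 at `p = 1/2`) and the alternating four-arm calculus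
(Nolin's Thm. 11 for `σ = BWBW` below `L(p)`, displayed as `hsepA`, and the a priori bound `hLB`):

* `sum_triAnnulus_eq_sum_shells` — `Σ_{v ∈ Λ_R ∖ Λ°_r} f(v) = Σ_{r ≤ k ≤ R} Σ_{|v| = k} f(v)`;
* `altFourArm_twoRadii_stability_of_altSeparation` — **Werner's Lemma 6.3 for the alternating
  `π̂` with BOTH radii free**: `c π̂^alt_{1/2}(a, b) ≤ π̂^alt_t(a, b) ≤ C π̂^alt_{1/2}(a, b)` for
  `a₀ ≤ a`, `2a ≤ b ≤ L(t, ε)` (from the fixed-radius statement `altFourArm_stability_of_altSeparation`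
  through `π̂^alt_s(a, b) ≍ π̂^alt_s(r₀, b)/π̂^alt_s(r₀, a)`, quasi-multiplicativity and
  sub-multiplicativity; Nolin 2008, Thm. 27 for `j = 4`, `σ = BWBW`, uniformly in `n ≤ N`);
* `alt_window_intensity_small` — **the integrated four-arm intensity is small well below `L(t)`**:
  `(t - 1/2) · N² π̂^alt_{1/2}(r₀, N) ≤ C (N/L(t, ε))^β` for `64 N ≤ L(t, ε)` (Werner 2009, Lecture 6,
  Cor. 6.3: integrating `d/dp h_p(L) ≥ c L² π̂_p(L)` from `1/2` to `t` gives
  `(t - 1/2) L² π̂(L) ≤ cst`, and `N² π̂(N) ≤ cst (N/L)^β L² π̂(L)` by quasi-multiplicativity and the a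
  priori bound at `1/2`).

## References

* W. Werner, *Lectures on two-dimensional critical percolation*, IAS/Park City Math. Ser. 16
  (2009), Lecture 6, Lemma 6.2, Cor. 6.3, Lemma 6.3, §5 [WernerPCMI2009].
* P. Nolin, Near-critical percolation in two dimensions, *Electron. J. Probab.* 13 (2008), Thm. 11,
  Prop. 12, Prop. 17, Thm. 27, Prop. 34 (arXiv 0711.4948: Thm. 10, Prop. 11, Prop. 16, Thm. 26,
  Prop. 32) [Nolin2008].
* H. Kesten, Scaling relations for 2D-percolation, *Comm. Math. Phys.* 109 (1987), (4.5), Lemma 8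
  [KestenScalingCMP1987].

Tree: `altFourArm_stability_of_altSeparation` (`AltFourArmStability.lean`),
`altFourArm_quasiMult_of_altSeparation` (`AltFourArmGlue.lean`),
`paraPivotalSum_lower_alt_of_altSeparation` (`AltPivotalLowerBound.lean`), `altFourArmProbAt_submult`
(`ArmExponentsFourArmAlt.lean`), `altFourArmProbAt_anti/mono_left/nonneg`, `hasDerivAt_triLRCrossingProb_two`,
`charLengthW_antitone` (`WernerCorrelationLengthProofs.lean`), `triLRCrossingProb_mem_Icc`
(`BoxCrossing.lean`), `sum_triBall_eq_sum_triSphere` (`OneArmPivotalSum.lean`). Mathlib: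
`Convex.mul_sub_le_image_sub_of_le_deriv`.
-/

noncomputable section

open MeasureTheory Set Finset Filter Topology

namespace Literature.Probability.Percolation

open LatticeModels

/-! ### Annulus sums as shell sums -/

/-- `Σ_{v ∈ triAnnulus r R} f(v) = Σ_{k ∈ [r, R]} Σ_{v ∈ ∂Λ_k} f(v)`. [folklore] -/
theorem sum_triAnnulus_eq_sum_shells (f : Site 2 → ℝ) (r R : ℕ) :
    ∑ v ∈ triAnnulus r R, f v = ∑ k ∈ Finset.Ico r (R + 1), ∑ v ∈ triSphere k, f v := by
  classical
  have h1 : ∑ v ∈ triAnnulus r R, f v = ∑ v ∈ triBall R, (if (r : ℤ) ≤ triNorm v then f v else 0) := by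
    rw [triAnnulus, Finset.sum_filter]
  rw [h1, sum_triBall_eq_sum_triSphere]
  have h2 : ∀ k ∈ Finset.range (R + 1), ∑ v ∈ triSphere k, (if (r : ℤ) ≤ triNorm v then f v else 0) =
      if r ≤ k then ∑ v ∈ triSphere k, f v else 0 := by
    intro k _
    by_cases hk : r ≤ k
    · rw [if_pos hk]
      refine Finset.sum_congr rfl fun v hv => ?_
      rw [mem_triSphere_iff] at hv
      rw [if_pos (by rw [hv]; exact_mod_cast hk)]
    · rw [if_neg hk]
      refine Finset.sum_eq_zero fun v hv => ?_
      rw [mem_triSphere_iff] at hv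
      rw [if_neg (by rw [hv]; exact_mod_cast hk)]
  rw [Finset.sum_congr rfl h2, ← Finset.sum_filter]
  congr 1
  ext k
  simp only [Finset.mem_filter, Finset.mem_range, Finset.mem_Ico]
  omega

/-! ### Two-radii stability of the alternating `π̂` -/

/-- **Werner's Lemma 6.3 for `π̂^alt` with both radii free** (Nolin 2008, Thm. 27 for `j = 4`,
`σ = BWBW`, uniformly in `n ≤ N`): from alternating separation `hsepA` and the a priori lower bound
`hLB`, for every small `ε` there are `a₀`, `δ > 0`, `0 < c`, `C` with
`c π̂^alt_{1/2}(a, b) ≤ π̂^alt_t(a, b) ≤ C π̂^alt_{1/2}(a, b)` for `1/2 ≤ t < 1/2 + δ`, `a₀ ≤ a`,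
`2a ≤ b`, and `b ≤ L(t, ε)` if `t > 1/2`. Proof: `π̂^alt_s(a, b)` is within constant factors of
`π̂^alt_s(r₀, b)/π̂^alt_s(r₀, a)` at `s = t` and `s = 1/2` (quasi-multiplicativity,
sub-multiplicativity, the a priori bound), and the fixed-radius stability
`altFourArm_stability_of_altSeparation` applies at the scales `a` and `b`. [cite: Nolin2008, §6 Thm. 27 (arXiv 0711.4948: Thm. 26)] [cite: WernerPCMI2009, Lecture 6, Lemma 6.3 and Cor. 6.2] -/
theorem altFourArm_twoRadii_stability_of_altSeparation
    (hsepA : ∃ ε₁ > (0 : ℝ), ∀ ⦃ε : ℝ⦄, 0 < ε → ε < ε₁ →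
      ∃ n₀ : ℕ, ∃ δ > (0 : ℝ), ∃ c > (0 : ℝ),
        ∀ t : unitInterval, 1 / 2 ≤ (t : ℝ) → (t : ℝ) < 1 / 2 + δ →
          ∀ n N : ℕ, n₀ ≤ n → 2 * n ≤ N → (1 / 2 < (t : ℝ) → N ≤ charLengthW ε t) →
            c * altFourArmProbAt t n N ≤ (triSitePercolation t).real (sepFourArm n N))
    (hLB : ∃ ε₁ > (0 : ℝ), ∀ ⦃ε : ℝ⦄, 0 < ε → ε < ε₁ →
      ∃ r₁ : ℕ, ∃ δ > (0 : ℝ), ∃ β > (0 : ℝ), ∃ c > (0 : ℝ),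
        ∀ t : unitInterval, 1 / 2 ≤ (t : ℝ) → (t : ℝ) < 1 / 2 + δ →
          ∀ m n : ℕ, r₁ ≤ m → m ≤ n → (1 / 2 < (t : ℝ) → n ≤ charLengthW ε t) →
            c * ((m : ℝ) / n) ^ (2 - β) ≤ altFourArmProbAt t m n) :
    ∃ ε₁ > (0 : ℝ), ∀ ⦃ε : ℝ⦄, 0 < ε → ε < ε₁ →
      ∃ a₀ : ℕ, ∃ δ > (0 : ℝ), ∃ c > (0 : ℝ), ∃ C : ℝ,
        ∀ t : unitInterval, 1 / 2 ≤ (t : ℝ) → (t : ℝ) < 1 / 2 + δ →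
          ∀ a b : ℕ, a₀ ≤ a → 2 * a ≤ b → (1 / 2 < (t : ℝ) → b ≤ charLengthW ε t) →
            c * altFourArmProbAt half a b ≤ altFourArmProbAt t a b ∧
              altFourArmProbAt t a b ≤ C * altFourArmProbAt half a b := by
  classical
  obtain ⟨εQ, hεQ, HQ⟩ := altFourArm_quasiMult_of_altSeparation hsepA
  obtain ⟨εS, hεS, HS⟩ := altFourArm_stability_of_altSeparation hsepA hLB
  obtain ⟨εL, hεL, HL⟩ := hLB
  refine ⟨min εQ (min εS εL), lt_min hεQ (lt_min hεS hεL), fun ε hε hε₁ => ?_⟩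
  obtain ⟨rQ, δQ, hδQ, cQ, hcQ, hQ⟩ := HQ hε (hε₁.trans_le (min_le_left _ _))
  obtain ⟨rL, δL, hδL, β, hβ, cL, hcL, hL⟩ := HL hε (hε₁.trans_le ((min_le_right _ _).trans (min_le_right _ _)))
  obtain ⟨r₁S, HS'⟩ := HS hε (hε₁.trans_le ((min_le_right _ _).trans (min_le_left _ _)))
  set r₀ : ℕ := max (max rQ rL) (max r₁S 1) with hr₀def
  have hrQ : rQ ≤ r₀ := (le_max_left _ _).trans (le_max_left _ _)
  have hrL : rL ≤ r₀ := (le_max_right _ _).trans (le_max_left _ _)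
  have hrS : r₁S ≤ r₀ := (le_max_left _ _).trans (le_max_right _ _)
  have hr₀1 : 1 ≤ r₀ := (le_max_right _ _).trans (le_max_right _ _)
  obtain ⟨n₁, δS, hδS, cS, hcS, CS, hS⟩ := HS' r₀ hrS
  have hCS0 : 0 < CS := by
    -- `c_S π̂_{1/2}(r₀, N) ≤ π̂_{1/2}(r₀, N) ≤ C_S π̂_{1/2}(r₀, N)` at `t = 1/2` with `π̂ > 0`
    have hN : max n₁ r₀ ≥ n₁ := le_max_left _ _
    have h := hS half (by norm_num [half]) (by show ((half : unitInterval) : ℝ) < 1 / 2 + δS; norm_num [half]; exact hδS)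
      (max n₁ r₀) hN (fun h => absurd h (by norm_num [half]))
    have hpos : 0 < altFourArmProbAt half r₀ (max n₁ r₀) := altFourArmProbAt_half_pos hr₀1 (le_max_right _ _)
    nlinarith [h.1, h.2]
  refine ⟨max (16 * r₀ + 8) (max n₁ 8), min δQ (min δL δS), lt_min hδQ (lt_min hδL hδS),
    cQ * cL / 4 * (cS / CS) * cQ, by positivity, 1 / cQ * (CS / cS) * (4 / (cQ * cL)), ?_⟩
  intro t ht htδ a b ha hab hbL
  have hδQ' : (t : ℝ) < 1 / 2 + δQ := htδ.trans_le (by linarith [min_le_left δQ (min δL δS)])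
  have hδL' : (t : ℝ) < 1 / 2 + δL :=
    htδ.trans_le (by linarith [(min_le_right δQ (min δL δS)).trans (min_le_left _ _)])
  have hδS' : (t : ℝ) < 1 / 2 + δS :=
    htδ.trans_le (by linarith [(min_le_right δQ (min δL δS)).trans (min_le_right _ _)])
  have ha16 : 16 * r₀ + 8 ≤ a := (le_max_left _ _).trans ha
  have han₁ : n₁ ≤ a := ((le_max_left _ _).trans (le_max_right _ _)).trans ha
  have ha8 : 8 ≤ a := ((le_max_right _ _).trans (le_max_right _ _)).trans ha
  have haL : 1 / 2 < (t : ℝ) → a ≤ charLengthW ε t := fun h => (by omega : a ≤ b).trans (hbL h)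
  have hhalf1 : (1 : ℝ) / 2 ≤ ((half : unitInterval) : ℝ) := by norm_num [half]
  have hhalf2 : ∀ δ : ℝ, 0 < δ → ((half : unitInterval) : ℝ) < 1 / 2 + δ := fun δ hδ => by
    norm_num [half]; exact hδ
  have hhalf3 : ¬ (1 / 2 < ((half : unitInterval) : ℝ)) := by norm_num [half]
  -- the key two-sided comparison with the ratio `π̂_s(r₀, b)/π̂_s(r₀, a)`, at a parameter `s`
  have key : ∀ s : unitInterval, 1 / 2 ≤ (s : ℝ) → (s : ℝ) < 1 / 2 + δQ → (s : ℝ) < 1 / 2 + δL →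
      (1 / 2 < (s : ℝ) → b ≤ charLengthW ε s) →
      0 < altFourArmProbAt s r₀ a ∧
      cQ * cL / 4 * (altFourArmProbAt s r₀ b / altFourArmProbAt s r₀ a) ≤ altFourArmProbAt s a b ∧
        altFourArmProbAt s a b ≤ 1 / cQ * (altFourArmProbAt s r₀ b / altFourArmProbAt s r₀ a) := by
    intro s hs hsQ hsL hsbL
    have hsaL : 1 / 2 < (s : ℝ) → a ≤ charLengthW ε s := fun h => (by omega : a ≤ b).trans (hsbL h)
    -- positivity of `π̂_s(r₀, a)` from the a priori bound
    have hπa : 0 < altFourArmProbAt s r₀ a := by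
      have h := hL s hs hsL r₀ a hrL (by omega) hsaL
      have : 0 < cL * ((r₀ : ℝ) / a) ^ (2 - β) := by
        apply mul_pos hcL
        apply Real.rpow_pos_of_pos
        exact div_pos (by exact_mod_cast (show 0 < r₀ by omega)) (by exact_mod_cast (show 0 < a by omega))
      linarith
    refine ⟨hπa, ?_, ?_⟩
    · -- lower: `π̂(r₀, b) ≤ π̂(r₀, a-1) π̂(a, b)` and `π̂(r₀, a-1) ≤ (4/(c_Q c_L)) π̂(r₀, a)`
      set R'' : ℕ := (a - 1) / 4 with hR''
      have hq := hQ s hs hsQ r₀ R'' a hrQ (by omega) (by omega) hsaL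
      have hanti : altFourArmProbAt s r₀ (a - 1) ≤ altFourArmProbAt s r₀ R'' :=
        altFourArmProbAt_anti s r₀ (by omega) (by omega)
      have hlow : cL / 4 ≤ altFourArmProbAt s (4 * R'') a := by
        refine le_trans ?_ (hL s hs hsL (4 * R'') a (by omega) (by omega) hsaL)
        have ha0 : (0 : ℝ) < a := by exact_mod_cast (show 0 < a by omega)
        have hb1 : (((4 * R'' : ℕ) : ℝ)) / a ≤ 1 := by
          rw [div_le_one ha0]; exact_mod_cast (show 4 * R'' ≤ a by omega)
        have hb0 : (1 : ℝ) / 2 ≤ (((4 * R'' : ℕ) : ℝ)) / a := by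
          rw [div_le_div_iff₀ (by norm_num) ha0, one_mul]; exact_mod_cast (show a ≤ 4 * R'' * 2 by omega)
        have hbpos : (0 : ℝ) < (((4 * R'' : ℕ) : ℝ)) / a := lt_of_lt_of_le (by norm_num) hb0
        have h1 : (((4 * R'' : ℕ) : ℝ) / a) ^ (2 : ℝ) ≤ (((4 * R'' : ℕ) : ℝ) / a) ^ (2 - β) :=
          Real.rpow_le_rpow_of_exponent_ge hbpos hb1 (by linarith)
        have h2 : ((1 : ℝ) / 2) ^ 2 ≤ (((4 * R'' : ℕ) : ℝ) / a) ^ (2 : ℝ) := by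
          rw [Real.rpow_two]; exact pow_le_pow_left₀ (by norm_num) hb0 2
        have : cL / 4 = cL * ((1 : ℝ) / 2) ^ 2 := by ring
        rw [this]
        exact mul_le_mul_of_nonneg_left (h2.trans h1) hcL.le
      -- `π̂(r₀, a-1) ≤ 4 π̂(r₀, a)/(c_Q c_L)`
      have hprev : altFourArmProbAt s r₀ (a - 1) ≤ 4 / (cQ * cL) * altFourArmProbAt s r₀ a := by
        have h1 : cQ * (altFourArmProbAt s r₀ (a - 1) * (cL / 4)) ≤ altFourArmProbAt s r₀ a := by
          calc cQ * (altFourArmProbAt s r₀ (a - 1) * (cL / 4))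
              ≤ cQ * (altFourArmProbAt s r₀ R'' * altFourArmProbAt s (4 * R'') a) := by
                apply mul_le_mul_of_nonneg_left _ hcQ.le
                exact mul_le_mul hanti hlow (by positivity) (altFourArmProbAt_nonneg _ _ _)
            _ ≤ altFourArmProbAt s r₀ a := hq
        rw [div_mul_eq_mul_div, le_div_iff₀ (mul_pos hcQ hcL)]
        nlinarith [h1]
      have hsub : altFourArmProbAt s r₀ b ≤ altFourArmProbAt s r₀ (a - 1) * altFourArmProbAt s a b := by
        have h := altFourArmProbAt_submult s (n₁ := r₀) (n₂ := a - 1) (n₃ := b) (by omega) (by omega)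
        rwa [Nat.sub_add_cancel (by omega : 1 ≤ a)] at h
      -- assemble: `(cQ cL/4) π̂(r₀,b)/π̂(r₀,a) ≤ π̂(a,b)`
      rw [mul_div_assoc', div_le_iff₀ hπa]
      have hπab := altFourArmProbAt_nonneg s a b
      calc cQ * cL / 4 * altFourArmProbAt s r₀ b
          ≤ cQ * cL / 4 * (altFourArmProbAt s r₀ (a - 1) * altFourArmProbAt s a b) :=
            mul_le_mul_of_nonneg_left hsub (by positivity)
        _ ≤ cQ * cL / 4 * (4 / (cQ * cL) * altFourArmProbAt s r₀ a * altFourArmProbAt s a b) := by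
            apply mul_le_mul_of_nonneg_left _ (by positivity)
            exact mul_le_mul_of_nonneg_right hprev hπab
        _ = altFourArmProbAt s a b * altFourArmProbAt s r₀ a := by field_simp
    · -- upper: `c_Q π̂(r₀, a) π̂(a, b) ≤ c_Q π̂(r₀, R') π̂(4R', b) ≤ π̂(r₀, b)`
      set R' : ℕ := (a + 3) / 4 with hR'
      have hq := hQ s hs hsQ r₀ R' b hrQ (by omega) (by omega) hsbL
      have hmono : altFourArmProbAt s a b ≤ altFourArmProbAt s (4 * R') b :=
        altFourArmProbAt_mono_left s (by omega) (by omega)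
      have hanti : altFourArmProbAt s r₀ a ≤ altFourArmProbAt s r₀ R' :=
        altFourArmProbAt_anti s r₀ (by omega) (by omega)
      have h1 : cQ * (altFourArmProbAt s r₀ a * altFourArmProbAt s a b) ≤ altFourArmProbAt s r₀ b :=
        calc cQ * (altFourArmProbAt s r₀ a * altFourArmProbAt s a b)
            ≤ cQ * (altFourArmProbAt s r₀ R' * altFourArmProbAt s (4 * R') b) := by
              apply mul_le_mul_of_nonneg_left _ hcQ.le
              exact mul_le_mul hanti hmono (altFourArmProbAt_nonneg _ _ _) (altFourArmProbAt_nonneg _ _ _)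
          _ ≤ altFourArmProbAt s r₀ b := hq
      rw [mul_div_assoc', le_div_iff₀ hπa]
      calc altFourArmProbAt s a b * altFourArmProbAt s r₀ a
          = 1 / cQ * (cQ * (altFourArmProbAt s r₀ a * altFourArmProbAt s a b)) := by field_simp
        _ ≤ 1 / cQ * altFourArmProbAt s r₀ b := mul_le_mul_of_nonneg_left h1 (by positivity)
  -- at `t` and at `1/2`
  obtain ⟨hπa_t, hlo_t, hup_t⟩ := key t ht hδQ' hδL' hbL
  obtain ⟨hπa_h, hlo_h, hup_h⟩ := key half hhalf1 (hhalf2 δQ hδQ) (hhalf2 δL hδL) (fun h => absurd h hhalf3)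
  -- stability at `r₀` for the scales `a` and `b`
  obtain ⟨hSa1, hSa2⟩ := hS t ht hδS' a han₁ haL
  obtain ⟨hSb1, hSb2⟩ := hS t ht hδS' b (han₁.trans (by omega)) hbL
  have hπb_h : 0 ≤ altFourArmProbAt half r₀ b := altFourArmProbAt_nonneg _ _ _
  -- the ratios: `ρ_t ≤ (C_S/c_S) ρ_{1/2}` and `ρ_t ≥ (c_S/C_S) ρ_{1/2}`
  set ρt : ℝ := altFourArmProbAt t r₀ b / altFourArmProbAt t r₀ a with hρt
  set ρh : ℝ := altFourArmProbAt half r₀ b / altFourArmProbAt half r₀ a with hρh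
  have hρh0 : 0 ≤ ρh := div_nonneg hπb_h hπa_h.le
  have hρ_up : ρt ≤ CS / cS * ρh := by
    rw [hρt, hρh, div_mul_div_comm, div_le_div_iff₀ hπa_t (mul_pos hcS hπa_h)]
    calc altFourArmProbAt t r₀ b * (cS * altFourArmProbAt half r₀ a)
        ≤ (CS * altFourArmProbAt half r₀ b) * (cS * altFourArmProbAt half r₀ a) :=
          mul_le_mul_of_nonneg_right hSb2 (by positivity)
      _ = CS * altFourArmProbAt half r₀ b * (cS * altFourArmProbAt half r₀ a) := by ring
      _ ≤ CS * altFourArmProbAt half r₀ b * altFourArmProbAt t r₀ a :=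
          mul_le_mul_of_nonneg_left hSa1 (by positivity)
  have hρ_lo : cS / CS * ρh ≤ ρt := by
    rw [hρt, hρh, div_mul_div_comm, div_le_div_iff₀ (mul_pos hCS0 hπa_h) hπa_t]
    calc cS * altFourArmProbAt half r₀ b * altFourArmProbAt t r₀ a
        ≤ cS * altFourArmProbAt half r₀ b * (CS * altFourArmProbAt half r₀ a) :=
          mul_le_mul_of_nonneg_left hSa2 (by positivity)
      _ = (cS * altFourArmProbAt half r₀ b) * (CS * altFourArmProbAt half r₀ a) := by ring
      _ ≤ altFourArmProbAt t r₀ b * (CS * altFourArmProbAt half r₀ a) :=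
          mul_le_mul_of_nonneg_right hSb1 (by positivity)
  -- `ρ_{1/2} ≤ (4/(c_Q c_L)) π̂_{1/2}(a, b)` and `ρ_{1/2} ≥ c_Q π̂_{1/2}(a, b)`
  have hρh_up : ρh ≤ 4 / (cQ * cL) * altFourArmProbAt half a b := by
    have : cQ * cL / 4 * ρh ≤ altFourArmProbAt half a b := hlo_h
    rw [div_mul_eq_mul_div, le_div_iff₀ (mul_pos hcQ hcL)]
    nlinarith [this]
  have hρh_lo : cQ * altFourArmProbAt half a b ≤ ρh := by
    have : altFourArmProbAt half a b ≤ 1 / cQ * ρh := hup_h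
    rw [one_div, ← div_eq_inv_mul, le_div_iff₀ hcQ] at this
    linarith
  constructor
  · -- lower bound at `t`
    calc cQ * cL / 4 * (cS / CS) * cQ * altFourArmProbAt half a b
        = cQ * cL / 4 * ((cS / CS) * (cQ * altFourArmProbAt half a b)) := by ring
      _ ≤ cQ * cL / 4 * ((cS / CS) * ρh) := by
          apply mul_le_mul_of_nonneg_left _ (by positivity)
          exact mul_le_mul_of_nonneg_left hρh_lo (by positivity)
      _ ≤ cQ * cL / 4 * ρt := mul_le_mul_of_nonneg_left hρ_lo (by positivity)
      _ ≤ altFourArmProbAt t a b := hlo_t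
  · -- upper bound at `t`
    calc altFourArmProbAt t a b ≤ 1 / cQ * ρt := hup_t
      _ ≤ 1 / cQ * (CS / cS * ρh) := mul_le_mul_of_nonneg_left hρ_up (by positivity)
      _ ≤ 1 / cQ * (CS / cS * (4 / (cQ * cL) * altFourArmProbAt half a b)) := by
          apply mul_le_mul_of_nonneg_left _ (by positivity)
          exact mul_le_mul_of_nonneg_left hρh_up (by positivity)
      _ = 1 / cQ * (CS / cS) * (4 / (cQ * cL)) * altFourArmProbAt half a b := by ring

/-! ### The integrated four-arm intensity is small well below `L(t)` -/

/-- **`(t - 1/2) · N² π̂^alt_{1/2}(r₀, N) ≤ C (N/L(t, ε))^β` for `64 N ≤ L(t, ε)`** (Werner 2009,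
Lecture 6, Cor. 6.3: "We integrate the identity of the previous lemma from `p = 1/2` to `p = p₀`
for `n = L(p₀) ≤ L(p)`"; here only the lower half of Lemma 6.2 is needed): with `L = L(t, ε)`,
`h_t(L) - h_{1/2}(L) ≤ 1` and `d/ds h_s(L) = Σ_x P_s(x pivotal) ≥ c_P L² π̂^alt_s(r₀, L) ≥
c_P c_S L² π̂^alt_{1/2}(r₀, L)` for `s ∈ [1/2, t]` (`paraPivotalSum_lower_alt_of_altSeparation`,
`altFourArm_stability_of_altSeparation`, `charLengthW_antitone`), so
`(t - 1/2) L² π̂^alt_{1/2}(r₀, L) ≤ 1/(c_P c_S)`; and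
`N² π̂^alt_{1/2}(r₀, N) ≤ (N/L)² L² π̂^alt_{1/2}(r₀, L)/(c_Q c_L (4N/L)^{2-β})` by
quasi-multiplicativity and the a priori bound at `1/2`. [cite: WernerPCMI2009, Lecture 6, Cor. 6.3 with Lemma 6.2 and Lemma 6.3] [cite: KestenScalingCMP1987, (4.5)] [cite: Nolin2008, §7.3 Prop. 34 (arXiv 0711.4948: Prop. 32)] -/
theorem alt_window_intensity_small
    (hsepA : ∃ ε₁ > (0 : ℝ), ∀ ⦃ε : ℝ⦄, 0 < ε → ε < ε₁ →
      ∃ n₀ : ℕ, ∃ δ > (0 : ℝ), ∃ c > (0 : ℝ),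
        ∀ t : unitInterval, 1 / 2 ≤ (t : ℝ) → (t : ℝ) < 1 / 2 + δ →
          ∀ n N : ℕ, n₀ ≤ n → 2 * n ≤ N → (1 / 2 < (t : ℝ) → N ≤ charLengthW ε t) →
            c * altFourArmProbAt t n N ≤ (triSitePercolation t).real (sepFourArm n N))
    (hLB : ∃ ε₁ > (0 : ℝ), ∀ ⦃ε : ℝ⦄, 0 < ε → ε < ε₁ →
      ∃ r₁ : ℕ, ∃ δ > (0 : ℝ), ∃ β > (0 : ℝ), ∃ c > (0 : ℝ),
        ∀ t : unitInterval, 1 / 2 ≤ (t : ℝ) → (t : ℝ) < 1 / 2 + δ →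
          ∀ m n : ℕ, r₁ ≤ m → m ≤ n → (1 / 2 < (t : ℝ) → n ≤ charLengthW ε t) →
            c * ((m : ℝ) / n) ^ (2 - β) ≤ altFourArmProbAt t m n) :
    ∃ ε₁ > (0 : ℝ), ∀ ⦃ε : ℝ⦄, 0 < ε → ε < ε₁ →
      ∃ r₁ : ℕ, ∀ r₀ ≥ r₁, ∃ n₁ : ℕ, ∃ δ > (0 : ℝ), ∃ β > (0 : ℝ), ∃ C : ℝ,
        ∀ t : unitInterval, 1 / 2 < (t : ℝ) → (t : ℝ) < 1 / 2 + δ →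
          ∀ N : ℕ, n₁ ≤ N → 64 * N ≤ charLengthW ε t →
            ((t : ℝ) - 1 / 2) * ((N : ℝ) ^ 2 * altFourArmProbAt half r₀ N) ≤
              C * ((N : ℝ) / charLengthW ε t) ^ β := by
  classical
  obtain ⟨εP, hεP, HP⟩ := paraPivotalSum_lower_alt_of_altSeparation hsepA
  obtain ⟨εQ, hεQ, HQ⟩ := altFourArm_quasiMult_of_altSeparation hsepA
  obtain ⟨εS, hεS, HS⟩ := altFourArm_stability_of_altSeparation hsepA hLB
  obtain ⟨εL, hεL, HL⟩ := hLB
  refine ⟨min (min εP εQ) (min εS εL), by positivity, fun ε hε hε₁ => ?_⟩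
  obtain ⟨rP, HP'⟩ := HP hε (hε₁.trans_le ((min_le_left _ _).trans (min_le_left _ _)))
  obtain ⟨rQ, δQ, hδQ, cQ, hcQ, hQ⟩ := HQ hε (hε₁.trans_le ((min_le_left _ _).trans (min_le_right _ _)))
  obtain ⟨r₁S, HS'⟩ := HS hε (hε₁.trans_le ((min_le_right _ _).trans (min_le_left _ _)))
  obtain ⟨rL, δL, hδL, β, hβ, cL, hcL, hL⟩ := HL hε (hε₁.trans_le ((min_le_right _ _).trans (min_le_right _ _)))
  refine ⟨max (max rP rQ) (max r₁S 1), fun r₀ hr₀ => ?_⟩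
  have hrP : rP ≤ r₀ := ((le_max_left _ _).trans (le_max_left _ _)).trans hr₀
  have hrQ : rQ ≤ r₀ := ((le_max_right _ _).trans (le_max_left _ _)).trans hr₀
  have hrS : r₁S ≤ r₀ := ((le_max_left _ _).trans (le_max_right _ _)).trans hr₀
  have hr₀1 : 1 ≤ r₀ := ((le_max_right _ _).trans (le_max_right _ _)).trans hr₀
  obtain ⟨nP, δP, hδP, cP, hcP, hP⟩ := HP' r₀ hrP
  obtain ⟨nS, δS, hδS, cS, hcS, CS, hS⟩ := HS' r₀ hrS
  refine ⟨max (max nP nS) (max (4 * r₀ + 1) (max rL 1)), min (min δP δS) (min δQ (min δL (1 / 4))),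
    by positivity, β, hβ, (4 : ℝ) ^ (β - 2) / (cP * cS * cQ * cL), ?_⟩
  intro t ht htδ N hN hNL
  have hδP' : (t : ℝ) < 1 / 2 + δP := htδ.trans_le (by linarith [(min_le_left (min δP δS) (min δQ (min δL (1/4:ℝ)))).trans (min_le_left _ _)])
  have hδS' : (t : ℝ) < 1 / 2 + δS := htδ.trans_le (by linarith [(min_le_left (min δP δS) (min δQ (min δL (1/4:ℝ)))).trans (min_le_right _ _)])
  have hδQ' : (t : ℝ) < 1 / 2 + δQ := htδ.trans_le (by linarith [(min_le_right (min δP δS) (min δQ (min δL (1/4:ℝ)))).trans (min_le_left _ _)])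
  have hδ4 : (t : ℝ) < 1 / 2 + 1 / 4 := htδ.trans_le (by linarith [(min_le_right (min δP δS) (min δQ (min δL (1/4:ℝ)))).trans ((min_le_right _ _).trans (min_le_right _ _))])
  have hnP : nP ≤ N := ((le_max_left _ _).trans (le_max_left _ _)).trans hN
  have hnS : nS ≤ N := ((le_max_right _ _).trans (le_max_left _ _)).trans hN
  have hN4 : 4 * r₀ + 1 ≤ N := ((le_max_left _ _).trans (le_max_right _ _)).trans hN
  have hNL' : rL ≤ N := ((le_max_left _ _).trans ((le_max_right _ _).trans (le_max_right _ _))).trans hN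
  have hN1 : 1 ≤ N := ((le_max_right _ _).trans ((le_max_right _ _).trans (le_max_right _ _))).trans hN
  set L : ℕ := charLengthW ε t with hLdef
  have hL1 : 64 ≤ L := by omega
  have hN0 : (0 : ℝ) < N := by exact_mod_cast (show 0 < N by omega)
  have hL0 : (0 : ℝ) < L := by exact_mod_cast (show 0 < L by omega)
  have hhalf1 : (1 : ℝ) / 2 ≤ ((half : unitInterval) : ℝ) := by norm_num [half]
  have hhalf2 : ∀ δ : ℝ, 0 < δ → ((half : unitInterval) : ℝ) < 1 / 2 + δ := fun δ hδ => by
    norm_num [half]; exact hδ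
  have hhalf3 : ¬ (1 / 2 < ((half : unitInterval) : ℝ)) := by norm_num [half]
  -- Step 1: `(t - 1/2) L² π̂_{1/2}(r₀, L) ≤ 1/(c_P c_S)` by integrating Russo's formula for `h_s(L)`
  set C₀ : ℝ := cP * cS * ((L : ℝ) ^ 2 * altFourArmProbAt half r₀ L) with hC₀
  have hstep1 : C₀ * ((t : ℝ) - 1 / 2) ≤ 1 := by
    set g : ℝ → ℝ := fun q => triLRCrossingProb (projIcc (0 : ℝ) 1 zero_le_one q) (2 * L) L with hg
    set D : Set ℝ := Icc (1 / 2) (t : ℝ) with hD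
    have ht1 : (t : ℝ) < 1 := by linarith
    have hIoo : ∀ q ∈ D, q ∈ Ioo (0 : ℝ) 1 := fun q hq => ⟨by linarith [hq.1], hq.2.trans_lt ht1⟩
    have hderiv : ∀ q ∈ D, HasDerivAt g (paraPivotalSum (projIcc (0 : ℝ) 1 zero_le_one q) L) q :=
      fun q hq => hasDerivAt_triLRCrossingProb_two L (hIoo q hq)
    have hcont : ContinuousOn g D := fun q hq => (hderiv q hq).continuousAt.continuousWithinAt
    have hdiff : DifferentiableOn ℝ g (interior D) := fun q hq =>
      (hderiv q (interior_subset hq)).differentiableAt.differentiableWithinAt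
    have hbound : ∀ q ∈ interior D, C₀ ≤ deriv g q := by
      intro q hq
      rw [hD, interior_Icc] at hq
      rw [(hderiv q ⟨hq.1.le, hq.2.le⟩).deriv]
      set s : unitInterval := projIcc (0 : ℝ) 1 zero_le_one q with hs
      have hsval : (s : ℝ) = q := by
        rw [hs, projIcc_of_mem zero_le_one ⟨by linarith [hq.1], by linarith [hq.2]⟩]
      have hs1 : 1 / 2 ≤ (s : ℝ) := by rw [hsval]; exact hq.1.le
      have hs1' : 1 / 2 < (s : ℝ) := by rw [hsval]; exact hq.1
      have hst : s ≤ t := Subtype.coe_le_coe.1 (by rw [hsval]; exact hq.2.le)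
      have hLs : L ≤ charLengthW ε s := charLengthW_antitone hε hs1' hst
      have hP := hP s hs1 (by rw [hsval]; linarith [hq.2]) L (hnP.trans (by omega)) fun _ => hLs
      have hSt := (hS s hs1 (by rw [hsval]; linarith [hq.2]) L (hnS.trans (by omega)) fun _ => hLs).1
      calc C₀ = cP * ((L : ℝ) ^ 2 * (cS * altFourArmProbAt half r₀ L)) := by rw [hC₀]; ring
        _ ≤ cP * ((L : ℝ) ^ 2 * altFourArmProbAt s r₀ L) := by
            apply mul_le_mul_of_nonneg_left _ hcP.le
            exact mul_le_mul_of_nonneg_left hSt (by positivity)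
        _ ≤ paraPivotalSum s L := hP
    have hmvt := (convex_Icc (1 / 2 : ℝ) (t : ℝ)).mul_sub_le_image_sub_of_le_deriv hcont hdiff hbound
      (1 / 2) (left_mem_Icc.2 ht.le) (t : ℝ) (right_mem_Icc.2 ht.le) ht.le
    have hg1 : g (t : ℝ) ≤ 1 := by
      rw [hg]; exact (triLRCrossingProb_mem_Icc _ _ _).2
    have hg0 : 0 ≤ g (1 / 2) := by
      rw [hg]; exact (triLRCrossingProb_mem_Icc _ _ _).1
    linarith
  -- Step 2: `N² π̂_{1/2}(r₀, N) ≤ (N/L)² (4N/L)^{β-2} L² π̂_{1/2}(r₀, L)/(c_Q c_L)` at `1/2`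
  have hq := hQ half hhalf1 (hhalf2 δQ hδQ) r₀ N L hrQ (by omega) (by omega) (fun h => absurd h hhalf3)
  have hlow : cL * (((4 * N : ℕ) : ℝ) / L) ^ (2 - β) ≤ altFourArmProbAt half (4 * N) L :=
    hL half hhalf1 (hhalf2 δL hδL) (4 * N) L (by omega) (by omega) (fun h => absurd h hhalf3)
  have hxpos : (0 : ℝ) < ((4 * N : ℕ) : ℝ) / L := by positivity
  have hwpos : 0 < cL * (((4 * N : ℕ) : ℝ) / L) ^ (2 - β) := mul_pos hcL (Real.rpow_pos_of_pos hxpos _)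
  have hπN : altFourArmProbAt half r₀ N ≤
      altFourArmProbAt half r₀ L / (cQ * (cL * (((4 * N : ℕ) : ℝ) / L) ^ (2 - β))) :=
    le_div_of_quasiMult_right hcQ hwpos (altFourArmProbAt_nonneg _ _ _) hlow hq
  -- Step 3: combine
  have ht0 : 0 ≤ (t : ℝ) - 1 / 2 := by linarith
  have hπL : 0 ≤ altFourArmProbAt half r₀ L := altFourArmProbAt_nonneg _ _ _
  have hkey : ((t : ℝ) - 1 / 2) * ((L : ℝ) ^ 2 * altFourArmProbAt half r₀ L) ≤ 1 / (cP * cS) := by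
    rw [le_div_iff₀ (mul_pos hcP hcS)]
    calc ((t : ℝ) - 1 / 2) * ((L : ℝ) ^ 2 * altFourArmProbAt half r₀ L) * (cP * cS)
        = C₀ * ((t : ℝ) - 1 / 2) := by rw [hC₀]; ring
      _ ≤ 1 := hstep1
  -- the power identity `(N/L)² (4N/L)^{β-2} = 4^{β-2} (N/L)^β`
  have hratio : (N : ℝ) / L ≤ 1 := by
    rw [div_le_one hL0]; exact_mod_cast (show N ≤ L by omega)
  have hrat0 : (0 : ℝ) < (N : ℝ) / L := div_pos hN0 hL0
  have hpow : ((N : ℝ) / L) ^ 2 / (((4 * N : ℕ) : ℝ) / L) ^ (2 - β) = (4 : ℝ) ^ (β - 2) * ((N : ℝ) / L) ^ β := by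
    have e1 : (((4 * N : ℕ) : ℝ) / L) = 4 * ((N : ℝ) / L) := by push_cast; ring
    rw [e1, Real.mul_rpow (by norm_num) hrat0.le, ← Real.rpow_two, div_eq_iff (by positivity)]
    have e2 : (β - 2) + (2 - β) = 0 := by ring
    have e3 : β + (2 - β) = 2 := by ring
    calc ((N : ℝ) / L) ^ (2 : ℝ) = (4 : ℝ) ^ ((β - 2) + (2 - β)) * ((N : ℝ) / L) ^ (β + (2 - β)) := by
          rw [e2, e3, Real.rpow_zero, one_mul]
      _ = (4 : ℝ) ^ (β - 2) * ((N : ℝ) / L) ^ β * ((4 : ℝ) ^ (2 - β) * ((N : ℝ) / L) ^ (2 - β)) := by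
          rw [Real.rpow_add (by norm_num : (0 : ℝ) < 4), Real.rpow_add hrat0]; ring
  calc ((t : ℝ) - 1 / 2) * ((N : ℝ) ^ 2 * altFourArmProbAt half r₀ N)
      ≤ ((t : ℝ) - 1 / 2) * ((N : ℝ) ^ 2 *
          (altFourArmProbAt half r₀ L / (cQ * (cL * (((4 * N : ℕ) : ℝ) / L) ^ (2 - β))))) := by
        apply mul_le_mul_of_nonneg_left _ ht0
        exact mul_le_mul_of_nonneg_left hπN (by positivity)
    _ = (((t : ℝ) - 1 / 2) * ((L : ℝ) ^ 2 * altFourArmProbAt half r₀ L)) *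
          (((N : ℝ) / L) ^ 2 / (((4 * N : ℕ) : ℝ) / L) ^ (2 - β)) / (cQ * cL) := by
        field_simp
    _ ≤ (1 / (cP * cS)) * (((N : ℝ) / L) ^ 2 / (((4 * N : ℕ) : ℝ) / L) ^ (2 - β)) / (cQ * cL) := by
        apply div_le_div_of_nonneg_right _ (by positivity)
        exact mul_le_mul_of_nonneg_right hkey (by positivity)
    _ = (4 : ℝ) ^ (β - 2) / (cP * cS * cQ * cL) * ((N : ℝ) / L) ^ β := by
        rw [hpow]; field_simp

end Literature.Probability.Percolation
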